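import Summits.ResolutionOfSingularities.ResolutionOfSingularities.Theorems.HilbertSamuelEliminationSigmaMaxModificationsCorridor3WLadderMovingIsoDefs
import HarnessLib

/-!
# [OURS · L1 W4.2] MODULE `Corridor3WLadderMovingAlt` (crux chain w42) — part 1/2: the ALTERNATION row `WtopAltM`

DEAL D16 «TRICHOTOMY COVER + ALT ROW» (res-L1-w42-plan-1 RULINGS v3.12-4 (V) 2026-08-27T08:49:06Z → res-type-012, namespace owner of
`…Cruxes.SigmaMaxModifications.IdeasL1Idea2R4`, the r4 vocabulary `…Corridor3WLadderMovingIsoDefs` p500943 / `…MovingIso` p501384).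
THE FINDING of (V): the typed rows (b)/(c)/(c-rep) and Ev-NonIso quantify over NEVER-isolated chains, the kernel + D7 cover EVENTUALLY-isolated
chains; chains that are isolated infinitely often AND non-isolated infinitely often («ALTERNATING») are covered by no typed sub-row — so the
pointed stub's by-name closer needs an ALTERNATION input.  This file types it, with the binders of `WtopRecIsoM` /
`MaxOriginNoMovingRecurrentNearChainAtQ` and the SECOND recurrence added (generic functional `NoMovingAlternatingNearChainFrom`, origin row
`MaxOriginNoMovingAlternatingNearChainAtQ`, and `WtopAltM p Q` = level `3`, grade `ē ≥ 3`, `B = Iso 3`).  Part 2/2 PROVES the trichotomy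
cover `wtop3PointedM_of_trichotomy : (∀ Q, WtopEvIsoM p Q) → WtopEvNonIsoM p QPointed → WtopAltM p QPointed → Wtop3PointedM p` (+ nonpointed
twin, + `wtop3PointedM_of_kernel` with D7 by name) = the POINTED STUB'S CLOSER SHAPE OF RECORD (CRUX-PLAN v3.8).  The ALT LAW itself
(`NoRecurrentIsoPointBirth3 → WtopAltM`, transition lemma «iso → non-iso = a fibre birth at an isolated point-step») is DEAL D17 (res-type-071);
`WtopAltM` is OPEN content (OURS row), consumed BY NAME.  OURS; NOT statements of [CossartJannsenSaito2020] nor of the manuscript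
[Hironaka2017]; AI typing, weaker than expert review.
-/

set_option linter.dupNamespace false

open CategoryTheory AlgebraicGeometry TopologicalSpace
open Summit.ResolutionOfSingularities.ResolutionOfSingularities.Theorems.CampaignW42
open Literature.AlgebraicGeometry.Resolution Literature.RingTheory.HilbertSamuel
open Literature.AlgebraicGeometry.CossartJannsenSaito2020
open Summit.ResolutionOfSingularities.ResolutionOfSingularities.Theses.HilbertSamuelElimination
open Summit.ResolutionOfSingularities.ResolutionOfSingularities.Theorems.SigmaMaxModificationsCorridor3
open Summit.ResolutionOfSingularities.ResolutionOfSingularities.Theorems.SigmaMaxModificationsCorridor3.Moving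
open Summit.ResolutionOfSingularities.ResolutionOfSingularities.Theorems.SigmaMaxModificationsCorridor3.Helpers (QPointed)

namespace Summit.ResolutionOfSingularities.ResolutionOfSingularities.Cruxes.SigmaMaxModifications.IdeasL1Idea2R4

universe u

/-! ## The alternation functional and rows -/

/-- [OURS] «No MOVING `G`-chain from `s₀` that visits `B` infinitely often AND leaves `B` infinitely often» — the tree's
`NoMovingRecurrentNearChainFrom R N ν s₀ G B` (p496136) with the second recurrence `∀ n, ∃ m ≥ n, ¬ B (c m)` added; the third piece of the
trichotomy «eventually `B` / eventually `¬ B` / alternating» of a moving chain (part 2/2 `noMovingNearChainFrom_iff_trichotomy`). [folklore] -/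
def NoMovingAlternatingNearChainFrom (R : ∀ S : Scheme.{u}, CentreSeq S → Prop) (N : ℕ) (ν : ℕ → ℕ)
    (s₀ : MarkedStage.{u}) (G B : MarkedStage.{u} → Prop) : Prop :=
  ¬ ∃ c : ℕ → MarkedStage.{u}, Reaches R N ν s₀ (c 0) ∧ (∀ n, CanonicalNearStep R N ν (c n) (c (n + 1))) ∧
      (∀ n, G (c n)) ∧ (∀ n, ∃ m, n ≤ m ∧ (c m).IsBlownUp R N ν) ∧
      (∀ n, ∃ m, n ≤ m ∧ B (c m)) ∧ ∀ n, ∃ m, n ≤ m ∧ ¬ B (c m)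

/-- [OURS] `Q`-origin form of the moving-alternating row (binders exactly those of `MaxOriginNoMovingRecurrentNearChainAtQ`, p496136).
[folklore] -/
def MaxOriginNoMovingAlternatingNearChainAtQ (p N : ℕ) (Q : ℕ → (ℕ → ℕ) → ∀ X : Scheme.{u}, X → Prop)
    (G B : MarkedStage.{u} → Prop) : Prop :=
  ∀ (R : ∀ S : Scheme.{u}, CentreSeq S → Prop), OracleFunctional R → OracleAdmissible R →
  ∀ (ν : ℕ → ℕ) (X : Scheme.{u}) [IsLocallyNoetherian X] (x : X), IsMaximalOrigin p N ν X x → Q N ν X x →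
    NoMovingAlternatingNearChainFrom R N ν (MarkedStage.init X x) G B

/-- [OURS · L1 W4.2 · D16] **ALT — THE ALTERNATION ROW `WtopAltM p Q`**: no MOVING chain of canonical near steps of grade `ē ≥ 3` from a
`Q`-maximal origin of characteristic `p` at level `3` that is ISOLATED in the Hilbert–Samuel locus infinitely often AND NON-isolated infinitely
often (infinitely many «excursions» iso → non-iso → … → iso).  OPEN (OURS claim): by DEAL D17 (res-type-071) an iso → non-iso transition is a
FIBRE BIRTH AT AN ISOLATED POINT-STEP inside `ℙ(Dir_{x_m}) ≅ ℙ²_κ` (`IsFibreBirthAt`, res-type-067 p513551), so `WtopAltM` follows from the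
eventual law `NoRecurrentIsoPointBirth3` («fibre births at isolated point-steps do not recur»); what should DECREASE across an excursion is the
ideation seed of round 8.  Vacuity audit (RULINGS v3.12-4 (V)): at `Q = QPointed` the origin is isolated at stage `0`, so every alternating chain
has a first excursion — not vacuous.  The trichotomy cover of part 2/2 makes it the third input of the pointed stub's closer.  NOT a statement
of [CossartJannsenSaito2020] (pointer: the dimension-2 analogue is the interleaving of Thm. 6.35's strata steps with Thm. 6.40's units).
[cite: CossartJannsenSaito2020, Thm. 6.35, Thm. 6.40, Rem. 6.29 (pointers)] -/
def WtopAltM (p : ℕ) (Q : ℕ → (ℕ → ℕ) → ∀ X : Scheme.{u}, X → Prop) : Prop :=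
  MaxOriginNoMovingAlternatingNearChainAtQ.{u} p 3 Q (fun s => 3 ≤ s.geomDirDim) fun s => Iso 3 s

end Summit.ResolutionOfSingularities.ResolutionOfSingularities.Cruxes.SigmaMaxModifications.IdeasL1Idea2R4
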